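import Literature.Analysis.UnboundedOperators.SemilinearMildFlow
import Literature.Analysis.UnboundedOperators.WeaklySingularDuhamel
import HarnessLib

/-!
# The smooth local mild flow of an abstract semilinear parabolic equation: short-time existence

Analysis/UnboundedOperators support file (everything proved; no definitions, no named facts).  The local
form of the smooth mild flow of

  `y(t) = T(t) y₀ + ∫₀ᵗ T(t − s) f ds − ∫₀ᵗ K(t − s) N(y(s), y(s)) ds`

(D. Henry, *Geometric Theory of Semilinear Parabolic Equations*, LNM 840 (1981), Thm. 3.3.3, Thm. 3.4.4;
A. Pazy, *Semigroups of Linear Operators and Applications to PDE* (1983), Thm. 6.3.1): for a strongly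
continuous family of contractions `T`, a family `K` strongly continuous on `(0, ∞)` with
`‖K(t)‖ ≤ C t^{−α}` (`0 ≤ C`, `α < 1`), a bounded bilinear `N`, a constant forcing `f` and a radius `ρ > 0`
there are a time `τ > 0` and a solution map `Ψ : E → C([0, τ]; E)`, `C^∞` on the ball `‖y₀‖ < ρ`, giving
the unique continuous mild solution and whose derivative solves the linearised equation
(`exists_smoothMildFlow`).  This merely chooses `τ` with `C τ^{1−α} ‖N‖ (ρ + 1)²/(1 − α) ≤ 1/2` and
`τ ‖f‖ ≤ 1/2` and combines the Duhamel operator of the sibling `WeaklySingularDuhamel.lean`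
(`exists_duhamelCLM`, `‖Φ‖ ≤ C τ^{1−α}/(1 − α)`) with `exists_smoothMildFlow_of_duhamel`
(`SemilinearMildFlow.lean`).  The semigroup law of `T` and the intertwining `K(s + t) = T(s) K(t)` of the
concrete `K = A^α e^{−tA}` are not needed for these conclusions.

## References

* D. Henry, *Geometric Theory of Semilinear Parabolic Equations*, LNM 840, Springer (1981), Thm. 3.3.3,
  Thm. 3.4.4, Cor. 3.4.6. [Henry1981]
* A. Pazy, *Semigroups of Linear Operators and Applications to Partial Differential Equations*, Springer
  (1983), §6.3, Thm. 6.3.1. [Pazy1983]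
-/

noncomputable section

open Set Filter MeasureTheory intervalIntegral Metric
open _root_.Topology
open scoped ContDiff

namespace Literature.Analysis.UnboundedOperators

variable {E : Type*} [NormedAddCommGroup E] [NormedSpace ℝ E] [CompleteSpace E]

/-- **The smooth local mild flow of an abstract semilinear parabolic equation** (Henry 1981, Thm. 3.3.3
and Thm. 3.4.4; Pazy 1983, Thm. 6.3.1).  Let `T(t)` (`t ≥ 0`) be a strongly continuous family of
contractions of a real Banach space `E`, `K(t)` (`t > 0`) bounded operators, strongly continuous on
`(0, ∞)`, with `‖K(t)‖ ≤ C t^{−α}` (`C ≥ 0`, `α < 1`), `N` a bounded bilinear map and `f ∈ E`.  For every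
`ρ > 0` there are `τ > 0` and `Ψ : E → C([0, τ]; E)` such that: `Ψ` is `C^∞` on the ball `‖y₀‖ < ρ`; for
`‖y₀‖ < ρ` the curve `Ψ y₀` solves `y(t) = T(t)y₀ + ∫₀ᵗ T(t − s) f ds − ∫₀ᵗ K(t − s) N(y(s), y(s)) ds` on
`[0, τ]`; it is the only continuous solution; and `w = DΨ(y₀) h` solves the linearised equation
`w(t) = T(t) h − ∫₀ᵗ K(t − s) (N(y(s), w(s)) + N(w(s), y(s))) ds`. [cite: Henry1981, Thm 3.4.4] -/
theorem exists_smoothMildFlow (T K : ℝ → E →L[ℝ] E) (hTnorm : ∀ t, 0 ≤ t → ‖T t‖ ≤ 1)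
    (hTc : ∀ y : E, Continuous fun t : ℝ => T t y) {α C : ℝ} (hα : α < 1) (hC : 0 ≤ C)
    (hK : ∀ t, 0 < t → ‖K t‖ ≤ C * t ^ (-α)) (hKc : ∀ y : E, ContinuousOn (fun t : ℝ => K t y) (Ioi 0))
    (N : E →L[ℝ] E →L[ℝ] E) (f : E) {ρ : ℝ} (hρ : 0 < ρ) :
    ∃ τ : ℝ, ∃ hτ : 0 < τ, ∃ Ψ : E → C(Icc (0 : ℝ) τ, E),
      ContDiffOn ℝ ∞ Ψ (ball 0 ρ) ∧
      (∀ y₀ ∈ ball (0 : E) ρ, ∀ t : Icc (0 : ℝ) τ,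
        Ψ y₀ t = T t y₀ + (∫ s in (0 : ℝ)..(t : ℝ), T ((t : ℝ) - s) f) -
          ∫ s in (0 : ℝ)..(t : ℝ), K ((t : ℝ) - s)
            (N (Ψ y₀ (Set.projIcc 0 τ hτ.le s)) (Ψ y₀ (Set.projIcc 0 τ hτ.le s)))) ∧
      (∀ y₀ ∈ ball (0 : E) ρ, ∀ z : C(Icc (0 : ℝ) τ, E),
        (∀ t : Icc (0 : ℝ) τ, z t = T t y₀ + (∫ s in (0 : ℝ)..(t : ℝ), T ((t : ℝ) - s) f) -
          ∫ s in (0 : ℝ)..(t : ℝ), K ((t : ℝ) - s)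
            (N (z (Set.projIcc 0 τ hτ.le s)) (z (Set.projIcc 0 τ hτ.le s)))) → z = Ψ y₀) ∧
      (∀ y₀ ∈ ball (0 : E) ρ, ∀ (h : E) (t : Icc (0 : ℝ) τ),
        fderiv ℝ Ψ y₀ h t = T t h - ∫ s in (0 : ℝ)..(t : ℝ), K ((t : ℝ) - s)
          (N (Ψ y₀ (Set.projIcc 0 τ hτ.le s)) (fderiv ℝ Ψ y₀ h (Set.projIcc 0 τ hτ.le s)) +
            N (fderiv ℝ Ψ y₀ h (Set.projIcc 0 τ hτ.le s)) (Ψ y₀ (Set.projIcc 0 τ hτ.le s)))) := by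
  have hα1 : 0 < 1 - α := by linarith
  -- a short time interval
  obtain ⟨τ, hτ, hτb, hτs⟩ := exists_pos_le_mul_rpow_le (β := 1 - α)
    (M := C / (1 - α) * ‖N‖ * (ρ + 1) ^ 2) (ε := 1 / 2) (b := 1 / (2 * (‖f‖ + 1))) hα1 one_half_pos
    (by positivity)
  -- the Duhamel operator on `C([0, τ]; E)` and the two smallness conditions
  obtain ⟨Φ, hΦ, hΦn⟩ := exists_duhamelCLM hτ hα hC K hK hKc
  have hΦN : ‖Φ‖ * ‖N‖ * (ρ + 1) ^ 2 ≤ 1 / 2 :=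
    calc ‖Φ‖ * ‖N‖ * (ρ + 1) ^ 2 ≤ (C * τ ^ (1 - α) / (1 - α)) * ‖N‖ * (ρ + 1) ^ 2 := by gcongr
      _ = C / (1 - α) * ‖N‖ * (ρ + 1) ^ 2 * τ ^ (1 - α) := by ring
      _ ≤ 1 / 2 := hτs
  have hτf : τ * ‖f‖ ≤ 1 / 2 :=
    calc τ * ‖f‖ ≤ 1 / (2 * (‖f‖ + 1)) * ‖f‖ := by gcongr
      _ = ‖f‖ / (2 * (‖f‖ + 1)) := by rw [div_mul_eq_mul_div, one_mul]
      _ ≤ 1 / 2 := by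
          rw [div_le_div_iff₀ (by positivity) (by positivity)]
          nlinarith [norm_nonneg f]
  exact ⟨τ, hτ, exists_smoothMildFlow_of_duhamel T K hTnorm hTc hα hC hK N f hρ hτ Φ hΦ hΦN hτf⟩

end Literature.Analysis.UnboundedOperators

end
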